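import Literature.Barriers.QuantumAdvantage.AaronsonChenSimulation
import Literature.Computability.Complexity.StackUnaryBits
import Literature.Computability.Complexity.MajorityEnumeration
import Literature.Computability.Complexity.WilsonOracle
import HarnessLib

/-!
# Aaronson–Chen 2017, Lemma 5.3: per-gate answer tables of the replaced run, and the strings queried at a gate

Support file for the machine half `aaronsonChen2017_lem53_machine` (`AaronsonChenSimulation.lean`)
of the named fact `aaronsonChen2017_lem53`, which vendors

* S. Aaronson, L. Chen, *Complexity-theoretic foundations of quantum supremacy experiments*,
  CCC 2017 (arXiv:1612.05903) [AaronsonChen2017], **Lemma 5.3** (p. 21; proof pp. 21–23): the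
  `SampBPP^{TQBF,O}` simulation `A` of a `SampBQP^{TQBF,O}` algorithm — "`A` proceeds by replacing
  each `O`-gate by a much simpler gate, one by one … It then simulates the final circuit with the
  help of the `TQBF` oracle" (p. 22); "we use a function `f_known` to encode our knowledge … we
  query all `x` with `Q(x) ≥ τ` … `g(x) = f_known(x)`" (p. 22); "all the computations can be done in
  `PSPACE`, and therefore can be implemented in `poly(n, 1/ε)` time with the help of the `TQBF`
  oracle" (p. 23).

The replacement process `AcSim.run` of `AaronsonChenSimulation.lean` answers the `t`-th query gate
by `TQBF ⊕ (O ∩ K_t)`, `K_t` its knowledge after the queries made there. The classical machine that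
realises it (`AaronsonChenProtocol.lean`, `AaronsonChenMachine.lean`) does not carry `O`: it
carries the finite TABLES `O ∩ K_t` it has learned. This file provides the table form of the
process and the list form of "what is queried at a gate", with the facts the protocol needs:

* `AcSim.tabRun tabs gs v` — the gate list run with the `u`-th gate answered by `TQBF ⊕ tabs u`;
  `AcSim.trueTabs` (the tables `O ∩ K_u` of the process) and `AcSim.run_vec_eq_tabRun` (**the
  replaced run is the tabled run with the true tables**); `AcSim.tabRun_congr` (a run only consults
  the tables of the gates it runs), `AcSim.normSq_tabRun` (unit norm, any tables),
  `AcSim.run_append`, `AcSim.newOf`/`AcSim.step_known`/`AcSim.mem_known_run_take_iff` (**the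
  knowledge after `m` gates is what was queried at the gates `n < m`**), `AcSim.trueTabs_take`,
  `AcSim.run_take_vec_eq_tabRun`;
* `qregFin`, `qregEquiv` — basis labels `y ∈ {0,1}^N` listed by the numeral `bitsToNat (y₀ ⋯ y_{N-1})`
  (the order in which the simulator samples by inverting the cumulative distribution);
* string utilities of the query schedule: `allStr L` (all strings of length `L`; this is the tree's
  `Complexity.Wilson.allStr` of `WilsonOracle.lean` re-exported into this namespace, with the aliases
  `mem_allStr_iff`, `AcSim.length_allStr` of its lemmas, and `allStr_eq_map_natBits` shows it lists
  the strings by numeral value, `natBits L 0, …, natBits L (2^L − 1)`), `padBlock W u = 0^{W-1-|u|} 1 u`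
  (fixed-width padded blocks) and `decodePad` (`decodePad_padBlock`, `true_mem_padBlock`), `evens`
  (even-position bits, `evens_eq`, `evens_map_range`), `lastN` (`lastN_take`);
* `AcSim.heavyList a e v` — the heavy tails `u`, `Q(1u) ≥ 1/a`, listed by numeral value;
  `AcSim.stageListOf a b g v` — **the strings queried at the gate `g` in the state `v`** (the whole
  table `{0,1}^{k-1}` when `2^{k-1} ≤ b`, else the heavy tails); `AcSim.mem_stageListOf_iff` (it
  lists exactly `newOf = heavySet ∪ smallSet`), `AcSim.length_heavyList_le` (**at most `a` heavy
  tails in a unit state** — magnitudes of distinct tails add up to at most the squared norm,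
  `AcSim.sum_queryWeight_singleton_le`), `AcSim.length_stageListOf_le` (at most `2a` strings per
  gate: "`A` queries the oracle only `poly(n, 1/ε)` times"), `AcSim.length_lt_of_mem_stageListOf`.

## References

* [AaronsonChen2017] arXiv:1612.05903, §5.3 (pp. 22–23), read via `lit read arxiv:1612.05903
  --pages 19-25` (tenure notes of `aaronsonChen2017_lem53`).
* [BennettBernsteinBrassardVazirani1997] Def. 3.2 (query magnitude), as vendored in
  `Literature/Computability/QuantumComplexity/HybridArgument.lean` (`queryWeight`).
-/

noncomputable section

namespace Literature.Barriers.QuantumAdvantage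

open MeasureTheory _root_.Computability Matrix Polynomial Literature.Computability.Complexity
  Literature.Computability.Cryptography
-- `natBits` here is the tree's `Literature.Computability.Complexity.natBits` (`StackUnaryBits.lean`);
-- the `testBit`-based `QuantumComplexity.natBits` of `OracleSeparationBQPPH.lean` (now in the import
-- closure) is hidden so that the short names stay unambiguous.
open Literature.Computability.QuantumComplexity hiding natBits length_natBits natBits_injective

variable {G : QGateSet} {N : ℕ}

/-! ### Runs with per-gate answer tables -/

namespace AcSim

/-- **The tabled run**: the gate list run in which the `u`-th gate (counting from the head, `u = 0,
1, …`), if it is a query gate, is answered by the language `TQBF ⊕ Y_u` for an explicit table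
`Y_u = tabs u ⊆ {0,1}*` — the replaced circuit "`C_final`" of the proof of Lemma 5.3 once the
learned values `g_t` of the `O`-gates are written down ("we replaced the `f_{n_i}` gate with a `g_i`
gate … `g(x) = f_known(x)` where known, `0` elsewhere"). [cite: AaronsonChen2017, §5.3 (p. 22 and p. 23, "Analysis of the final circuit")] -/
def tabRun (tabs : ℕ → Set (List Bool)) : List (QGate G N) → (QReg N → ℂ) → (QReg N → ℂ)
  | [], v => v
  | g :: gs, v => tabRun (fun u => tabs (u + 1)) gs (g.toMatrix (oracleJoin TQBF (tabs 0)) *ᵥ v)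

/-- The tabled run on the empty gate list (definitional). [folklore] -/
@[simp] theorem tabRun_nil (tabs : ℕ → Set (List Bool)) (v : QReg N → ℂ) :
    tabRun (G := G) tabs [] v = v := rfl

/-- The tabled run on `g :: gs` (definitional). [folklore] -/
@[simp] theorem tabRun_cons (tabs : ℕ → Set (List Bool)) (g : QGate G N) (gs : List (QGate G N))
    (v : QReg N → ℂ) :
    tabRun tabs (g :: gs) v = tabRun (fun u => tabs (u + 1)) gs (g.toMatrix (oracleJoin TQBF (tabs 0)) *ᵥ v) := rfl

/-- **The true tables** of the replacement process against the oracle `O` from the stage `s`: the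
`u`-th gate of the replaced run answers `TQBF ⊕ (O ∩ K_u)`, `K_u` the knowledge after the queries
made at that gate (`AcSim.step`), i.e. the `known` set of the process run over the first `u + 1`
gates. [cite: AaronsonChen2017, §5.3 (p. 22, "g(x) = f_known(x)")] -/
def trueTabs (O : Set (List Bool)) (a b : ℕ) (gs : List (QGate G N)) (s : State N) (u : ℕ) :
    Set (List Bool) :=
  O ∩ (run O a b (gs.take (u + 1)) s).known

/-- **The replaced run is the tabled run with the true tables.** [cite: AaronsonChen2017, §5.3 (p. 23, "C_final")] -/
theorem run_vec_eq_tabRun (O : Set (List Bool)) (a b : ℕ) :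
    ∀ (gs : List (QGate G N)) (s : State N), (run O a b gs s).vec = tabRun (trueTabs O a b gs s) gs s.vec
  | [], s => rfl
  | g :: gs, s => by
    rw [run_cons, run_vec_eq_tabRun O a b gs (step O a b s g), tabRun_cons]
    have h0 : g.toMatrix (oracleJoin TQBF (trueTabs O a b (g :: gs) s 0)) *ᵥ s.vec = (step O a b s g).vec := by
      cases g with
      | gate g e => rfl
      | oracle k e => simp [trueTabs, step, QGate.toMatrix_oracle]
    rw [h0]
    rfl

/-- The tabled run only consults the tables of the gates it runs. [folklore] -/
theorem tabRun_congr {tabs tabs' : ℕ → Set (List Bool)} :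
    ∀ (gs : List (QGate G N)) (v : QReg N → ℂ), (∀ u < gs.length, tabs u = tabs' u) →
      tabRun tabs gs v = tabRun tabs' gs v
  | [], _, _ => rfl
  | g :: gs, v, h => by
    rw [tabRun_cons, tabRun_cons, h 0 (by simp)]
    exact tabRun_congr gs _ fun u hu => h (u + 1) (by simpa using hu)

/-- The tabled run preserves the norm over a unitary gate set (whatever the tables). [folklore] -/
theorem normSq_tabRun (hG : G.IsUnitary) :
    ∀ (tabs : ℕ → Set (List Bool)) (gs : List (QGate G N)) (v : QReg N → ℂ), normSq (tabRun tabs gs v) = normSq v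
  | _, [], _ => rfl
  | tabs, g :: gs, v => by
    rw [tabRun_cons, normSq_tabRun hG]
    cases g with
    | gate g e => exact normSq_mulVec_of_mem_unitaryGroup (placeGate_mem_unitaryGroup_holds e (hG g)) _
    | oracle k e =>
      rw [QGate.toMatrix_oracle]
      exact normSq_mulVec_of_mem_unitaryGroup
        (placeGate_mem_unitaryGroup_holds e (oracleGate_mem_unitaryGroup_holds _ k)) _

/-- The process run over a concatenation. [folklore] -/
theorem run_append (O : Set (List Bool)) (a b : ℕ) :
    ∀ (gs gs' : List (QGate G N)) (s : State N), run O a b (gs ++ gs') s = run O a b gs' (run O a b gs s)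
  | [], _, _ => rfl
  | g :: gs, gs', s => by rw [List.cons_append, run_cons, run_cons, run_append O a b gs gs']

/-- **The strings queried at a gate** in the state `v`: none at a gate symbol, the heavy tails and
the small tables at a query gate (`newKnown = known ∪ newOf`). [cite: AaronsonChen2017, §5.3 (p. 22)] -/
def newOf (a b : ℕ) : QGate G N → (QReg N → ℂ) → Set (List Bool)
  | .gate _ _, _ => ∅
  | .oracle k e, v => heavySet a e v ∪ smallSet b k

/-- One step adds the strings queried at the gate to the knowledge. [folklore] -/
theorem step_known (O : Set (List Bool)) (a b : ℕ) (s : State N) (g : QGate G N) :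
    (step O a b s g).known = s.known ∪ newOf a b g s.vec := by
  cases g with
  | gate g e => simp [step, newOf]
  | oracle k e => rfl

/-- **The knowledge after the first `m` gates** is what was queried at the gates `n < m`, each in the
state of the process before it. [cite: AaronsonChen2017, §5.3 (p. 22, "f_known")] -/
theorem mem_known_run_take_iff (O : Set (List Bool)) (a b : ℕ) (gs : List (QGate G N)) (s : State N)
    (v : List Bool) : ∀ m : ℕ,
    v ∈ (run O a b (gs.take m) s).known ↔
      v ∈ s.known ∨ ∃ n < m, ∃ g, gs[n]? = some g ∧ v ∈ newOf a b g (run O a b (gs.take n) s).vec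
  | 0 => by simp
  | m + 1 => by
    by_cases hm : m < gs.length
    · rw [List.take_add_one, List.getElem?_eq_getElem hm, Option.toList_some, run_append, run_cons, run_nil,
        step_known, Set.mem_union, mem_known_run_take_iff O a b gs s v m]
      constructor
      · rintro ((h | ⟨n, hn, g, hg, hv⟩) | h)
        · exact Or.inl h
        · exact Or.inr ⟨n, Nat.lt_succ_of_lt hn, g, hg, hv⟩
        · exact Or.inr ⟨m, Nat.lt_succ_self m, gs[m], List.getElem?_eq_getElem hm, h⟩
      · rintro (h | ⟨n, hn, g, hg, hv⟩)
        · exact Or.inl (Or.inl h)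
        · rcases Nat.lt_succ_iff_lt_or_eq.1 hn with hn | rfl
          · exact Or.inl (Or.inr ⟨n, hn, g, hg, hv⟩)
          · rw [List.getElem?_eq_getElem hm, Option.some.injEq] at hg
            subst hg
            exact Or.inr hv
    · rw [not_lt] at hm
      have ih := mem_known_run_take_iff O a b gs s v m
      rw [List.take_of_length_le hm] at ih
      rw [List.take_of_length_le (Nat.le_succ_of_le hm), ih]
      constructor
      · rintro (h | ⟨n, hn, g, hg, hv⟩)
        · exact Or.inl h
        · exact Or.inr ⟨n, Nat.lt_succ_of_lt hn, g, hg, hv⟩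
      · rintro (h | ⟨n, hn, g, hg, hv⟩)
        · exact Or.inl h
        · refine Or.inr ⟨n, ?_, g, hg, hv⟩
          have : n < gs.length := by
            by_contra hge
            rw [List.getElem?_eq_none (not_lt.1 hge)] at hg
            cases hg
          omega

/-- The true tables of a prefix of the gate list are those of the whole list, below its length. [folklore] -/
theorem trueTabs_take (O : Set (List Bool)) (a b : ℕ) (gs : List (QGate G N)) (s : State N) {n u : ℕ}
    (hu : u < n) : trueTabs O a b (gs.take n) s u = trueTabs O a b gs s u := by
  simp only [trueTabs, List.take_take, min_eq_left (Nat.succ_le_of_lt hu)]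

/-- **The state of the process before gate `n` is the tabled run of the first `n` gates with the
true tables.** [cite: AaronsonChen2017, §5.3 (p. 23)] -/
theorem run_take_vec_eq_tabRun (O : Set (List Bool)) (a b : ℕ) (gs : List (QGate G N)) (s : State N) (n : ℕ) :
    (run O a b (gs.take n) s).vec = tabRun (trueTabs O a b gs s) (gs.take n) s.vec := by
  rw [run_vec_eq_tabRun]
  exact tabRun_congr _ _ fun u hu => trueTabs_take O a b gs s (lt_of_lt_of_le hu (by simp))

end AcSim

/-! ### The order on basis labels used by the sampler -/

/-- A basis label `y ∈ {0,1}^N` read as a binary numeral (the tree's little-endian `bitsToNat` of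
the bit string `y₀ y₁ ⋯ y_{N-1}`), a number below `2^N`. [folklore] -/
def qregFin (N : ℕ) (y : QReg N) : Fin (2 ^ N) :=
  ⟨bitsToNat (List.ofFn y), by simpa using bitsToNat_lt (List.ofFn y)⟩

/-- Value of `qregFin`. [folklore] -/
@[simp] theorem qregFin_val (N : ℕ) (y : QReg N) : (qregFin N y : ℕ) = bitsToNat (List.ofFn y) := rfl

/-- Reading basis labels as numerals is a bijection `{0,1}^N ≃ [0, 2^N)`. [folklore] -/
theorem qregFin_bijective (N : ℕ) : Function.Bijective (qregFin N) := by
  rw [Fintype.bijective_iff_injective_and_card]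
  refine ⟨fun y y' h => ?_, by simp⟩
  have hv : (qregFin N y : ℕ) = qregFin N y' := by rw [h]
  simp only [qregFin_val] at hv
  exact List.ofFn_injective (Kannan.eq_of_bitsToNat_eq (by simp) hv)

/-- The listing of the basis labels by their numeral values. [folklore] -/
def qregEquiv (N : ℕ) : QReg N ≃ Fin (2 ^ N) :=
  Equiv.ofBijective (qregFin N) (qregFin_bijective N)

/-- `qregEquiv` is `qregFin`. [folklore] -/
@[simp] theorem qregEquiv_apply (N : ℕ) (y : QReg N) : qregEquiv N y = qregFin N y := rfl

/-! ### Strings: fixed-width blocks, padding, interleaving -/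

-- `allStr L`, all bit strings of length `L`, is the tree's `Literature.Computability.Complexity.Wilson.allStr`
-- (`WilsonOracle.lean`, `allStr (L+1) = allStr L >>= fun x => [0x, 1x]`), re-exported into this
-- namespace (its membership and counting lemmas `mem_allStr_iff`, `length_allStr` below are the
-- ones of that file, under the names the files downstream use); the closed form by numeral value
-- used by the simulator and by its later `PSPACE` analysis is `allStr_eq_map_natBits` below.
export Literature.Computability.Complexity.Wilson (allStr)

/-- `List.range (2 n)` by consecutive pairs `2j, 2j+1`. [folklore] -/
theorem range_two_mul_eq_flatMap (n : ℕ) :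
    List.range (2 * n) = (List.range n).flatMap fun j => [2 * j, 2 * j + 1] := by
  induction n with
  | zero => rfl
  | succ n ih =>
    rw [List.range_succ, List.flatMap_append, ← ih, Nat.mul_succ, List.range_succ, List.range_succ]
    simp

/-- **`allStr L` lists the strings of length `L` by numeral value**: `natBits L 0, …,
natBits L (2^L − 1)` (the order in which the simulator lists heavy tails and in which its later
`PSPACE` analysis counts them). [folklore] -/
theorem allStr_eq_map_natBits : ∀ L : ℕ, allStr L = (List.range (2 ^ L)).map (natBits L)
  | 0 => rfl
  | L + 1 => by
    rw [Wilson.allStr, allStr_eq_map_natBits L, pow_succ', range_two_mul_eq_flatMap, List.flatMap_map,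
      List.map_flatMap]
    refine List.flatMap_congr fun j _ => ?_
    have h1 : (2 * j) % 2 = 0 := Nat.mul_mod_right 2 j
    have h2 : (2 * j) / 2 = j := Nat.mul_div_cancel_left j two_pos
    have h3 : (2 * j + 1) % 2 = 1 := by omega
    have h4 : (2 * j + 1) / 2 = j := by omega
    simp [natBits, h1, h2, h3, h4]

/-- **A padded block** of width exactly `W` spelling the string `u`: `0^{W−1−|u|} 1 u` — leading
zeros, a marker, the payload (cut to width `W`; faithful when `|u| < W`). [folklore] -/
def padBlock (W : ℕ) (u : List Bool) : List Bool :=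
  (List.replicate (W - 1 - u.length) false ++ true :: u).take W

/-- **Decoding a padded block**: drop the leading zeros and the marker (`0^p 1 u ↦ u`; a block
without marker decodes to `ε`). [folklore] -/
def decodePad : List Bool → List Bool
  | [] => []
  | false :: l => decodePad l
  | true :: l => l

/-- The bits at even positions `0, 2, 4, …` of a string. [folklore] -/
def evens : List Bool → List Bool
  | [] => []
  | [b] => [b]
  | b :: _ :: l => b :: evens l

/-- The last `W` symbols of a string (all of it if shorter). [folklore] -/
def lastN (W : ℕ) (l : List Bool) : List Bool :=
  l.drop (l.length - W)

/-- A padded block has width exactly `W`. [folklore] -/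
@[simp] theorem length_padBlock (W : ℕ) (u : List Bool) : (padBlock W u).length = W := by
  simp only [padBlock, List.length_take, List.length_append, List.length_replicate, List.length_cons]
  omega

/-- When the payload fits, the cut does nothing. [folklore] -/
theorem padBlock_eq_of_lt {W : ℕ} {u : List Bool} (h : u.length < W) :
    padBlock W u = List.replicate (W - 1 - u.length) false ++ true :: u := by
  rw [padBlock, List.take_of_length_le]
  simp only [List.length_append, List.length_replicate, List.length_cons]
  omega

/-- Decoding skips leading zeros. [folklore] -/
@[simp] theorem decodePad_replicate_append (p : ℕ) (l : List Bool) :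
    decodePad (List.replicate p false ++ l) = decodePad l := by
  induction p with
  | zero => rfl
  | succ p ih => rw [List.replicate_succ, List.cons_append]; exact ih

/-- An all-zero block decodes to `ε`. [folklore] -/
@[simp] theorem decodePad_replicate (p : ℕ) : decodePad (List.replicate p false) = [] := by
  have h := decodePad_replicate_append p []
  rwa [List.append_nil] at h

/-- **Decoding a padded block recovers the payload** (when it fits). [folklore] -/
theorem decodePad_padBlock {W : ℕ} {u : List Bool} (h : u.length < W) : decodePad (padBlock W u) = u := by
  rw [padBlock_eq_of_lt h, decodePad_replicate_append]
  rfl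

/-- A padded block of positive width carries the marker. [folklore] -/
theorem true_mem_padBlock {W : ℕ} (hW : 0 < W) (u : List Bool) : true ∈ padBlock W u := by
  rw [padBlock, List.mem_iff_getElem]
  refine ⟨W - 1 - u.length, ?_, ?_⟩
  · simp only [List.length_take, List.length_append, List.length_replicate, List.length_cons]
    omega
  · rw [List.getElem_take, List.getElem_append_right (by simp)]
    simp

/-- An all-zero block carries no marker. [folklore] -/
theorem true_not_mem_replicate (p : ℕ) : true ∉ List.replicate p false := by
  simp [List.mem_replicate]

/-- **The even-position bits, in closed form.** [folklore] -/
theorem evens_eq : ∀ l : List Bool,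
    evens l = (List.range ((l.length + 1) / 2)).map fun e => l[2 * e]?.getD false
  | [] => rfl
  | [b] => by simp [evens]
  | a :: b :: l => by
    rw [evens, evens_eq l]
    have hl : ((a :: b :: l).length + 1) / 2 = (l.length + 1) / 2 + 1 := by
      simp only [List.length_cons]; omega
    rw [hl, List.range_succ_eq_map, List.map_cons, List.map_map]
    simp only [mul_zero, List.getElem?_cons_zero, Option.getD_some, List.cons.injEq, true_and]
    refine List.map_congr_left fun e _ => ?_
    simp only [Function.comp_apply, Nat.mul_succ]
    rfl

/-- The number of even positions. [folklore] -/
@[simp] theorem length_evens (l : List Bool) : (evens l).length = (l.length + 1) / 2 := by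
  rw [evens_eq]; simp

/-- The even-position bits of a string listed by a function of the position. [folklore] -/
theorem evens_map_range (f : ℕ → Bool) (i : ℕ) :
    evens ((List.range i).map f) = (List.range ((i + 1) / 2)).map fun e => f (2 * e) := by
  rw [evens_eq]
  simp only [List.length_map, List.length_range]
  refine List.map_congr_left fun e he => ?_
  rw [List.mem_range] at he
  rw [List.getElem?_map, List.getElem?_range (by omega)]
  rfl

/-- `lastN` of a string ending with a block of the right width is that block. [folklore] -/
theorem lastN_append_of_length {W : ℕ} (l₁ l₂ : List Bool) (h : l₂.length = W) : lastN W (l₁ ++ l₂) = l₂ := by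
  simp [lastN, h]

/-- The last `W` bits of the first `(q + 1) W` bits are the bits `[qW, (q+1)W)`. [folklore] -/
theorem lastN_take {W q : ℕ} {l : List Bool} (h : (q + 1) * W ≤ l.length) :
    lastN W (l.take ((q + 1) * W)) = (l.drop (q * W)).take W := by
  have e : l.take ((q + 1) * W) = l.take (q * W) ++ (l.drop (q * W)).take W := by
    rw [← List.take_add]
    congr 1
    ring
  rw [e, lastN_append_of_length]
  simp only [List.length_take, List.length_drop]
  have : (q + 1) * W = q * W + W := by ring
  omega

/-- The strings of `allStr L` are exactly the strings of length `L`: the tree's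
`Wilson.mem_allStr_iff`, under the name used here and downstream. [folklore] -/
alias mem_allStr_iff := Wilson.mem_allStr_iff

/-- `allStr L` has no duplicates. [folklore] -/
theorem nodup_allStr (L : ℕ) : (allStr L).Nodup := by
  rw [allStr_eq_map_natBits]
  refine (List.nodup_range).map_on fun i hi j hj h => ?_
  rw [List.mem_range] at hi hj
  rw [← bitsToNat_natBits hi, h, bitsToNat_natBits hj]

/-! ### The strings queried at a gate, as a list -/

namespace AcSim

/-- **The heavy tails at a query gate, listed by numeral value**: the tails `u ∈ {0,1}^{k-1}` with
query magnitude `Q(1u) ≥ 1/a` in the state `v` (the elements of `AcSim.heavySet a e v`).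
[cite: AaronsonChen2017, §5.3 (p. 22, "we query all x with Q(x) ≥ τ")] -/
def heavyList (a : ℕ) {k : ℕ} (e : Fin (k + 1) ↪ Fin N) (v : QReg N → ℂ) : List (List Bool) :=
  open scoped Classical in
  (allStr (k - 1)).filter fun u => decide ((1 : ℝ) / a ≤ queryWeight ({true :: u} : Set (List Bool)) e v)

/-- **The strings queried at a gate**, listed by numeral value: none at a gate symbol or a query gate
without query wires; the whole table `{0,1}^{k-1}` if it is small (`2^{k-1} ≤ b`), else the heavy
tails. [cite: AaronsonChen2017, §5.3 (p. 22, "Construction and Analysis of g"; "we can simply query all the positions")] -/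
def stageListOf (a b : ℕ) : QGate G N → (QReg N → ℂ) → List (List Bool)
  | .gate _ _, _ => []
  | .oracle 0 _, _ => []
  | .oracle (k + 1) e, v => if 2 ^ k ≤ b then allStr k else heavyList a e v

/-- Membership in the heavy list. [folklore] -/
theorem mem_heavyList_iff {a k : ℕ} (e : Fin (k + 1) ↪ Fin N) (v : QReg N → ℂ) (u : List Bool) :
    u ∈ heavyList a e v ↔ u.length = k - 1 ∧ (1 : ℝ) / a ≤ queryWeight ({true :: u} : Set (List Bool)) e v := by
  classical
  simp [heavyList, List.mem_filter, mem_allStr_iff]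

/-- **The list of queried strings lists exactly the newly known strings** (`heavySet ∪ smallSet`).
[cite: AaronsonChen2017, §5.3 (p. 22)] -/
theorem mem_stageListOf_iff (a b : ℕ) (g : QGate G N) (v : QReg N → ℂ) (u : List Bool) :
    u ∈ stageListOf a b g v ↔ u ∈ newOf a b g v := by
  cases g with
  | gate g e => simp [stageListOf, newOf]
  | oracle k e =>
    cases k with
    | zero => simp [stageListOf, newOf, heavySet, smallSet]
    | succ k =>
      simp only [stageListOf, newOf, heavySet, smallSet, Set.mem_union, Set.mem_setOf_eq]
      split_ifs with hb
      · rw [mem_allStr_iff]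
        constructor
        · intro h
          exact Or.inr ⟨by omega, by rwa [h]⟩
        · rintro (⟨h, -⟩ | ⟨h, -⟩) <;> omega
      · rw [mem_heavyList_iff, Nat.add_sub_cancel]
        constructor
        · rintro ⟨h, hq⟩
          exact Or.inl ⟨by omega, hq⟩
        · rintro (⟨h, hq⟩ | ⟨h, hb'⟩)
          · exact ⟨by omega, hq⟩
          · exact absurd ((show u.length = k by omega) ▸ hb') hb

/-- Every queried string is shorter than the number of wires (a tail of a query register that also
has an answer wire). [folklore] -/
theorem length_lt_of_mem_stageListOf {a b : ℕ} {g : QGate G N} {v : QReg N → ℂ} {u : List Bool}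
    (h : u ∈ stageListOf a b g v) : u.length < N := by
  cases g with
  | gate g e => simp [stageListOf] at h
  | oracle k e =>
    cases k with
    | zero => simp [stageListOf] at h
    | succ k =>
      have hk : k + 1 + 1 ≤ N := by simpa using Fintype.card_le_of_embedding e
      simp only [stageListOf] at h
      split_ifs at h with hb
      · rw [mem_allStr_iff] at h
        omega
      · rw [mem_heavyList_iff, Nat.add_sub_cancel] at h
        omega

/-- Distinct tails have disjoint query events, so their query magnitudes add up to at most the
squared norm. [cite: BennettBernsteinBrassardVazirani1997, Def. 3.2] -/
theorem sum_queryWeight_singleton_le {k : ℕ} (e : Fin (k + 1) ↪ Fin N) (v : QReg N → ℂ)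
    (T : Finset (List Bool)) :
    ∑ u ∈ T, queryWeight ({true :: u} : Set (List Bool)) e v ≤ normSq v := by
  classical
  unfold queryWeight normSq
  rw [Finset.sum_comm]
  refine Finset.sum_le_sum fun x _ => ?_
  simp only [Set.mem_singleton_iff]
  rw [Finset.sum_ite, Finset.sum_const_zero, add_zero, Finset.sum_const, nsmul_eq_mul]
  have hcard : (T.filter fun u => queryOf e x = true :: u).card ≤ 1 := by
    refine Finset.card_le_one.2 fun u hu u' hu' => ?_
    simp only [Finset.mem_filter] at hu hu'
    exact (List.cons_eq_cons.1 (hu.2.symm.trans hu'.2)).2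
  calc ((T.filter fun u => queryOf e x = true :: u).card : ℝ) * ‖v x‖ ^ 2 ≤ 1 * ‖v x‖ ^ 2 := by
        gcongr
        exact_mod_cast hcard
    _ = ‖v x‖ ^ 2 := one_mul _

/-- **At most `a` heavy tails** in a unit state: each has query magnitude `≥ 1/a` and the magnitudes
add up to at most `1`. [cite: AaronsonChen2017, §5.3 (p. 22, "poly(n, 1/ε) queries")] -/
theorem length_heavyList_le {a : ℕ} (ha : 1 ≤ a) {k : ℕ} (e : Fin (k + 1) ↪ Fin N) {v : QReg N → ℂ}
    (hv : normSq v = 1) : (heavyList a e v).length ≤ a := by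
  classical
  have hnd : (heavyList a e v).Nodup := (nodup_allStr _).filter _
  have hlen : (heavyList a e v).length = (heavyList a e v).toFinset.card :=
    (List.toFinset_card_of_nodup hnd).symm
  have hsum : ((heavyList a e v).toFinset.card : ℝ) * ((1 : ℝ) / a) ≤
      ∑ u ∈ (heavyList a e v).toFinset, queryWeight ({true :: u} : Set (List Bool)) e v := by
    rw [← nsmul_eq_mul]
    refine Finset.card_nsmul_le_sum _ _ _ fun u hu => ?_
    rw [List.mem_toFinset] at hu
    exact ((mem_heavyList_iff e v u).1 hu).2
  have h1 := (hsum.trans (sum_queryWeight_singleton_le e v _)).trans_eq hv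
  have ha' : (0 : ℝ) < a := by exact_mod_cast ha
  rw [mul_one_div, div_le_one ha'] at h1
  rw [hlen]
  exact_mod_cast h1

/-- The whole table has `2^L` entries: the tree's `Wilson.length_allStr`, under the name used
here. [folklore] -/
alias length_allStr := Wilson.length_allStr

attribute [simp] length_allStr

/-- **At most `2a` strings are queried at a gate** of the replaced run (budget `a = b ≥ 1`, unit
state). [cite: AaronsonChen2017, §5.3 (p. 22)] -/
theorem length_stageListOf_le {a : ℕ} (ha : 1 ≤ a) (g : QGate G N) {v : QReg N → ℂ} (hv : normSq v = 1) :
    (stageListOf a a g v).length ≤ 2 * a := by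
  cases g with
  | gate g e => simp [stageListOf]
  | oracle k e =>
    cases k with
    | zero => simp [stageListOf]
    | succ k =>
      simp only [stageListOf]
      split_ifs with hb
      · rw [length_allStr]; omega
      · exact (length_heavyList_le ha e hv).trans (by omega)

end AcSim

end Literature.Barriers.QuantumAdvantage

end
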